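import Summits.BirchSwinnertonDyer.BirchSwinnertonDyer.Theorems.SignedLowerHalvesSmallImageLowerHalfBothSignsRttD2SeqSemilocKonig
import Summits.BirchSwinnertonDyer.BirchSwinnertonDyer.Theorems.SignedLowerHalvesSmallImageLowerHalfBothSignsRttJunctionShaLocBounded
import Literature.Algebra.Module.CompleteNakayama
import HarnessLib

/-!
# Route `SignedLowerHalves`, crux L `SmallImageLowerHalfBothSigns` (stmt-BirchSwinnertonDyer-23599), line `rtt_w3` v30 — stub S3β″ (`stub_junctionPT_ns`), input N5-(i), part 2:
# NAKAYAMA ALONG THE SEMILOCAL TOWER — `𝐇^i_{Iw,w}` IS FINITELY GENERATED OVER `ℤ_p` (hence over `Λ`, and `Λ`-TORSION) AS SOON AS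
# (E1) `0 → X_j → X_{j+1} → X_1 → 0` is exact on `H^i` in the middle at every level, (E2) `p = incl ∘ red`, and (B) the mod-`p` levels `Lloc_w(n,1)` are uniformly bounded

WIDTH seat `bsd-line-slh-p3-w3` g26 under LEAD `cruxlead-stmt-BirchSwinnertonDyer-23599` g14 (cell `bsd-ssimc`); helper `--supports stmt-BirchSwinnertonDyer-23599`
(design memo `Lines/rtt_w3-DESIGN-S3beta-w3-g25.md`, rev 4 §6, RECIPE N5 «`hfin/htors` for `Π_w L_w.H` by the compact-Nakayama pattern»). ONE DEFINITION WITH BODY (`semilocRedLE`, the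
iterated reduction) + THEOREMS; no named fact, no instance, no `sorry`. HONEST FRAMING: this is the GENERIC half of T5's hypotheses `hfin`/`htors` (p812244; used by `…RttD2SeqSemilocAssembly`
p816814): the three LEVELWISE inputs (E1), (E2), (B) at each `w ∈ S₀` are DISPLAYED HYPOTHESES here (their discharge — the coefficient short exact sequence `0 → 𝒪⊗μ_{p^j} → 𝒪⊗μ_{p^{j+1}} →
𝒪⊗μ_p → 0` through `IsSES.exists_cohomologyMap_eq_of_cohomologyMap_eq_zero`, and `#H¹(K_w, Maps(Γ_K ⧸ U_n, X_1)) ≤ B` by Tate's local Euler characteristic + orbit counting — is part 3).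
Nothing about S3β″, crux L or BSD is proved; all remain OPEN and are proved for NO curve.

* §1 `semilocRedLE` (iterated `semilocRed`), `proj_eq_semilocRedLE`.
* §2 ★★ `SemilocIwasawaCohomologyDataO.exists_nsmul_eq_of_forall_proj_one_eq_zero` — **`p`-DIVISIBILITY LIFTS ALONG THE TOWER**: under (E1)/(E2), an `x ∈ L.H` with all `proj_{n,1} x = 0` is
  `p • y` (the preimage sets `{y | incl y = proj_{n,j+1} x}` are finite, non-empty, transition-closed; Kőnig, part 1; pins (P3)/(P4)).
* §3 `SemilocIwasawaCohomologyDataO.eq_zero_of_forall_exists_pow_nsmul` — `L.H` is `p`-adically separated (levels are `p^k`-torsion, (P3)).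
* §4 ★★★ `SemilocIwasawaCohomologyDataO.moduleFinite_padicInt_of_levels` — (E1)+(E2)+(B) ⟹ `Module.Finite ℤ_p L.H` (`L.H ⧸ p ↪` compatible sequences in `Π_n Lloc_w(n,1)`, at most `B` of
  them by LEAD g14's `finite_and_natCard_le_of_bounded_levels`; then Matsumura's complete Nakayama `PadicInt.finite_of_forall_eq_zero_of_forall_exists`); `moduleFinite_iwasawa_of_levels`.
* §5 ★ `isTorsion_of_moduleFinite_padicInt` (GENERIC: a `Λ`-module finitely generated over `ℤ_p` is `Λ`-torsion — the chain `span{x, Tx, …, T^m x}` stabilises, giving a MONIC relation),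
  `isTorsion_pi_of_forall`; ★★★ `moduleFinite_and_isTorsion_pi_of_levels` — T5's `hfin` ∧ `htors` for `Π_{w∈S₀} (L w).H` from the levelwise inputs at each `w ∈ S₀`.
References: [Matsumura1987] Thm. 8.4; [NeukirchSchmidtWingberg2008] (5.3.9)–(5.3.10), (8.6.2)–(8.6.3); [Washington1997] §13.2 Lemma 13.16; [Rubin2000] App. B.3; [PerrinRiou1994Invent] §1.3.
-/

set_option autoImplicit false
set_option linter.dupNamespace false -- D-0017: single-problem summit, the namespace repeats the problem name by design
noncomputable section

open scoped Classical
open NumberField IsDedekindDomain Field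

namespace Summit.BirchSwinnertonDyer.BirchSwinnertonDyer.Theorems.SmallImageRttD2Seq

open Literature.NumberTheory.EllipticCurves Literature.NumberTheory.GaloisRepresentations

/-! ## §1. The iterated reduction -/

section Semiloc

variable {K : Type} [Field K] [NumberField K] {p : ℕ} [Fact p.Prime] (S : Set (PadicAlgCl p)) (κ : ZpExtension K p) {γ : absoluteGaloisGroup K}
  (θ' : absoluteGaloisGroup K →ₜ* (padicCoeffIntegers S)ˣ) (P : Set (HeightOneSpectrum (𝓞 K))) (w : HeightOneSpectrum (𝓞 K)) (i : ℕ)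

/-- **The iterated reduction `Lloc_w(n,k′) → Lloc_w(n,k)` (`k ≤ k′`)** (`sndLE` of T1-b₁'s `semilocRed`). [cite: Kato2004Asterisque, §8.2 (p. 180)] -/
def semilocRedLE (n : ℕ) {k k' : ℕ} (h : k ≤ k') : semilocCoh S κ θ' P w n k' i →+ semilocCoh S κ θ' P w n k i :=
  sndLE (G := fun n k ↦ semilocCoh S κ θ' P w n k i) (fun n k ↦ semilocRed S κ θ' P w n k i) n h

/-- `semilocRedLE` along `k ≤ k` is the identity. [folklore] -/
theorem semilocRedLE_refl (n k : ℕ) (y : semilocCoh S κ θ' P w n k i) : semilocRedLE S κ θ' P w i n (le_refl k) y = y :=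
  sndLE_refl (G := fun n k ↦ semilocCoh S κ θ' P w n k i) (fun n k ↦ semilocRed S κ θ' P w n k i) n k y

/-- Peeling `semilocRedLE` at the top. [folklore] -/
theorem semilocRedLE_succ (n : ℕ) {k k' : ℕ} (h : k ≤ k') (h' : k ≤ k' + 1) (y : semilocCoh S κ θ' P w n (k' + 1) i) :
    semilocRedLE S κ θ' P w i n h' y = semilocRedLE S κ θ' P w i n h (semilocRed S κ θ' P w n k' i y) :=
  sndLE_succ (G := fun n k ↦ semilocCoh S κ θ' P w n k i) (fun n k ↦ semilocRed S κ θ' P w n k i) n h h' y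

variable {S κ θ' P w i}

/-- The projections of a semilocal Iwasawa datum are `semilocRedLE`-compatible ((P2) iterated). [cite: Kato2004Asterisque, §8.2 (p. 180)] -/
theorem SemilocIwasawaCohomologyDataO.proj_eq_semilocRedLE (L : SemilocIwasawaCohomologyDataO S κ γ θ' P w i) (x : L.H) (n : ℕ) {k k' : ℕ} (h : k ≤ k') :
    L.proj n k x = semilocRedLE S κ θ' P w i n h (L.proj n k' x) := by
  induction k', h using Nat.le_induction with
  | base => rw [semilocRedLE_refl]
  | succ k' h ih => rw [semilocRedLE_succ S κ θ' P w i n h, L.proj_red, ih]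

/-! ## §2. `p`-divisibility lifts along the tower -/

/-- ★★ **`p`-DIVISIBILITY LIFTS ALONG THE SEMILOCAL TOWER.** Let `ι_{n,j} : Lloc_w(n,j) → Lloc_w(n,j+1)` («incl», intended: `H^i` of `𝒪 ⊗ μ_{p^j} ↪ 𝒪 ⊗ μ_{p^{j+1}}`) commute with the
corestrictions and reductions, with (E2) `p · z = ι(red z)` and (E1) every `z ∈ Lloc_w(n,j+1)` whose reduction to `Lloc_w(n,1)` vanishes is `ι y` (exactness of
`H^i(X_j) → H^i(X_{j+1}) → H^i(X_1)` in the middle); let all levels be finite. Then every `x ∈ 𝐇^i_{Iw,w}` with `proj_{n,1} x = 0` for all `n` is `p • y`: the preimage sets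
`{y ∈ Lloc_w(n,j) | ι y = proj_{n,j+1} x}` are non-empty (E1), finite and closed under both transitions; Kőnig (part 1) and pin (P4) give `y`, pin (P3) gives `p • y = x` by (E2).
[cite: NeukirchSchmidtWingberg2008, (8.6.2)–(8.6.3)] [cite: Rubin2000, Prop. B.1.1, App. B.3] -/
theorem SemilocIwasawaCohomologyDataO.exists_nsmul_eq_of_forall_proj_one_eq_zero (L : SemilocIwasawaCohomologyDataO S κ γ θ' P w i)
    (hfin : ∀ n k : ℕ, Finite (semilocCoh S κ θ' P w n k i))
    (ι : ∀ n j : ℕ, semilocCoh S κ θ' P w n j i →+ semilocCoh S κ θ' P w n (j + 1) i)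
    (hιc : ∀ (n j : ℕ) (y : semilocCoh S κ θ' P w (n + 1) j i), semilocCores S κ θ' P w n (j + 1) i (ι (n + 1) j y) = ι n j (semilocCores S κ θ' P w n j i y))
    (hιr : ∀ (n j : ℕ) (y : semilocCoh S κ θ' P w n (j + 1) i), semilocRed S κ θ' P w n (j + 1) i (ι n (j + 1) y) = ι n j (semilocRed S κ θ' P w n j i y))
    (hp : ∀ (n j : ℕ) (z : semilocCoh S κ θ' P w n (j + 1) i), p • z = ι n j (semilocRed S κ θ' P w n j i z))
    (hex : ∀ (n j : ℕ) (z : semilocCoh S κ θ' P w n (j + 1) i), semilocRedLE S κ θ' P w i n (Nat.le_add_left 1 j) z = 0 → ∃ y, ι n j y = z)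
    (x : L.H) (hx : ∀ n : ℕ, L.proj n 1 x = 0) : ∃ y : L.H, p • y = x := by
  let A : ∀ n j : ℕ, Set (semilocCoh S κ θ' P w n j i) := fun n j ↦ {y | ι n j y = L.proj n (j + 1) x}
  have hAc : ∀ (n j : ℕ) (y : semilocCoh S κ θ' P w (n + 1) j i), y ∈ A (n + 1) j → semilocCores S κ θ' P w n j i y ∈ A n j := fun n j y hy ↦ by
    change ι n j _ = _
    rw [← hιc, show ι (n + 1) j y = L.proj (n + 1) (j + 1) x from hy, L.proj_cores]
  have hAr : ∀ (n j : ℕ) (y : semilocCoh S κ θ' P w n (j + 1) i), y ∈ A n (j + 1) → semilocRed S κ θ' P w n j i y ∈ A n j := fun n j y hy ↦ by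
    change ι n j _ = _
    rw [← hιr, show ι n (j + 1) y = L.proj n (j + 2) x from hy, L.proj_red]
  have hne : ∀ m : ℕ, (A m m).Nonempty := fun m ↦ by
    obtain ⟨y, hy⟩ := hex m m (L.proj m (m + 1) x) (by rw [← L.proj_eq_semilocRedLE]; exact hx m)
    exact ⟨y, hy⟩
  obtain ⟨y, hy⟩ := L.exists_proj_mem_of_forall_nonempty hfin A hAc hAr hne
  refine ⟨y, L.eq_of_forall_proj_eq fun n j ↦ ?_⟩
  rw [map_nsmul]
  cases j with
  | zero =>
    have h0 : ∀ z : semilocCoh S κ θ' P w n 0 i, z = 0 := fun z ↦ by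
      have h := semilocCoh_torsion S κ θ' P w n 0 i z
      rwa [pow_zero, one_smul] at h
    rw [h0 (p • L.proj n 0 y), h0 (L.proj n 0 x)]
  | succ j =>
    rw [hp, L.proj_red]
    exact hy n j

/-! ## §3. `p`-adic separatedness -/

/-- **`𝐇^i_{Iw,w}` is `p`-adically separated**: an element divisible by every power of `p` vanishes (its level-`(n,k)` projection is `p^k`-torsion times something; pin (P3)).
[cite: NeukirchSchmidtWingberg2008, (5.3.9)–(5.3.10)] [cite: Lang1990, Ch. 5 §1] -/
theorem SemilocIwasawaCohomologyDataO.eq_zero_of_forall_exists_pow_nsmul (L : SemilocIwasawaCohomologyDataO S κ γ θ' P w i) (x : L.H)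
    (h : ∀ m : ℕ, ∃ y : L.H, x = p ^ m • y) : x = 0 := by
  refine L.proj_injective x fun n k ↦ ?_
  obtain ⟨y, rfl⟩ := h k
  rw [map_nsmul, semilocCoh_torsion]

/-! ## §4. Finite generation over `ℤ_p` and over `Λ` -/

/-- ★★★ **NAKAYAMA ALONG THE TOWER: `𝐇^i_{Iw,w}` IS FINITELY GENERATED OVER `ℤ_p`** (for the `ℤ_p`-structure through `Λ = ℤ_p⟦T⟧`, `moduleIwasawa`) as soon as (E1)/(E2) hold and
(B) the mod-`p` levels `Lloc_w(n,1)` have `Nat.card ≤ B` for all `n`: the classes of `L.H ⧸ p` are separated by the compatible sequences `(proj_{n,1} x)_n` (§2), of which there are at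
most `B` (LEAD g14 `finite_and_natCard_le_of_bounded_levels`), and `L.H` is `p`-adically separated (§3) — Matsumura's Nakayama for separated modules over the complete ring `ℤ_p`
(`PadicInt.finite_of_forall_eq_zero_of_forall_exists`). [cite: Matsumura1987, Thm. 8.4] [cite: NeukirchSchmidtWingberg2008, (5.3.10)] [cite: Washington1997, §13.2 Lemma 13.16] -/
theorem SemilocIwasawaCohomologyDataO.moduleFinite_padicInt_of_levels (L : SemilocIwasawaCohomologyDataO S κ γ θ' P w i)
    (hfin : ∀ n k : ℕ, Finite (semilocCoh S κ θ' P w n k i))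
    (ι : ∀ n j : ℕ, semilocCoh S κ θ' P w n j i →+ semilocCoh S κ θ' P w n (j + 1) i)
    (hιc : ∀ (n j : ℕ) (y : semilocCoh S κ θ' P w (n + 1) j i), semilocCores S κ θ' P w n (j + 1) i (ι (n + 1) j y) = ι n j (semilocCores S κ θ' P w n j i y))
    (hιr : ∀ (n j : ℕ) (y : semilocCoh S κ θ' P w n (j + 1) i), semilocRed S κ θ' P w n (j + 1) i (ι n (j + 1) y) = ι n j (semilocRed S κ θ' P w n j i y))
    (hp : ∀ (n j : ℕ) (z : semilocCoh S κ θ' P w n (j + 1) i), p • z = ι n j (semilocRed S κ θ' P w n j i z))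
    (hex : ∀ (n j : ℕ) (z : semilocCoh S κ θ' P w n (j + 1) i), semilocRedLE S κ θ' P w i n (Nat.le_add_left 1 j) z = 0 → ∃ y, ι n j y = z)
    {B : ℕ} (hB : ∀ n : ℕ, Nat.card (semilocCoh S κ θ' P w n 1 i) ≤ B) :
    letI := L.moduleIwasawa
    letI : Module ℤ_[p] L.H := Module.compHom L.H (algebraMap ℤ_[p] (IwasawaAlgebra p))
    Module.Finite ℤ_[p] L.H := by
  letI := L.moduleIwasawa
  letI : Module ℤ_[p] L.H := Module.compHom L.H (algebraMap ℤ_[p] (IwasawaAlgebra p))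
  have hsmul : ∀ (m : ℕ) (y : L.H), ((p : ℤ_[p]) ^ m) • y = p ^ m • y := fun m y ↦ by
    change (algebraMap ℤ_[p] (IwasawaAlgebra p) ((p : ℤ_[p]) ^ m)) • y = p ^ m • y
    rw [map_pow, map_natCast, ← Nat.cast_pow, Nat.cast_smul_eq_nsmul]
  -- the compatible sequences of mod-`p` projections: at most `B` of them
  let Φ : L.H → (∀ n : ℕ, semilocCoh S κ θ' P w n 1 i) := fun x n ↦ L.proj n 1 x
  let R : Set (∀ n : ℕ, semilocCoh S κ θ' P w n 1 i) := Set.range Φ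
  have hR := finite_and_natCard_le_of_bounded_levels (H := R) (Lv := fun n _ ↦ semilocCoh S κ θ' P w n 1 i) (fun n _ ρ ↦ ρ.1 n)
    (fun n _ ↦ semilocCores S κ θ' P w n 1 i) (fun _ _ ↦ id) (fun n k ρ ↦ by obtain ⟨x, hx⟩ := ρ.2; rw [← hx]; exact L.proj_cores n 1 x) (fun _ _ _ ↦ rfl)
    (fun ρ ρ' h ↦ Subtype.ext (funext fun n ↦ h n 0)) (fun n _ ↦ hfin n 1) (fun n _ ↦ hB n)
  haveI : Finite R := hR.1
  letI : Fintype R := Fintype.ofFinite R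
  -- representatives
  let xr : R → L.H := fun ρ ↦ Classical.choose ρ.2
  have hxr : ∀ ρ : R, Φ (xr ρ) = ρ.1 := fun ρ ↦ Classical.choose_spec ρ.2
  refine Literature.Algebra.Module.PadicInt.finite_of_forall_eq_zero_of_forall_exists p
    (fun y hy ↦ L.eq_zero_of_forall_exists_pow_nsmul y fun m ↦ ?_) xr fun m ↦ ?_
  · obtain ⟨y', hy'⟩ := hy m
    exact ⟨y', by rw [hy', hsmul]⟩
  · let ρ : R := ⟨Φ m, ⟨m, rfl⟩⟩
    have hdiff : ∀ n : ℕ, L.proj n 1 (m - xr ρ) = 0 := fun n ↦ by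
      have h := congrFun (hxr ρ) n
      change L.proj n 1 (xr ρ) = L.proj n 1 m at h
      rw [map_sub, h, sub_self]
    obtain ⟨y, hy⟩ := L.exists_nsmul_eq_of_forall_proj_one_eq_zero hfin ι hιc hιr hp hex (m - xr ρ) hdiff
    refine ⟨fun ρ' ↦ if ρ' = ρ then 1 else 0, y, ?_⟩
    have h1 := hsmul 1 y
    rw [pow_one, pow_one] at h1
    rw [h1, hy]
    simp only [ite_smul, one_smul, zero_smul, Finset.sum_ite_eq', Finset.mem_univ, if_true]
    abel

/-- ★★★ **`𝐇^i_{Iw,w}` is finitely generated over `Λ`** under (E1)/(E2)/(B) (restriction of scalars `ℤ_p → Λ`). [cite: Washington1997, §13.2 Lemma 13.16] [cite: NeukirchSchmidtWingberg2008, (5.3.10)] -/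
theorem SemilocIwasawaCohomologyDataO.moduleFinite_iwasawa_of_levels (L : SemilocIwasawaCohomologyDataO S κ γ θ' P w i)
    (hfin : ∀ n k : ℕ, Finite (semilocCoh S κ θ' P w n k i))
    (ι : ∀ n j : ℕ, semilocCoh S κ θ' P w n j i →+ semilocCoh S κ θ' P w n (j + 1) i)
    (hιc : ∀ (n j : ℕ) (y : semilocCoh S κ θ' P w (n + 1) j i), semilocCores S κ θ' P w n (j + 1) i (ι (n + 1) j y) = ι n j (semilocCores S κ θ' P w n j i y))
    (hιr : ∀ (n j : ℕ) (y : semilocCoh S κ θ' P w n (j + 1) i), semilocRed S κ θ' P w n (j + 1) i (ι n (j + 1) y) = ι n j (semilocRed S κ θ' P w n j i y))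
    (hp : ∀ (n j : ℕ) (z : semilocCoh S κ θ' P w n (j + 1) i), p • z = ι n j (semilocRed S κ θ' P w n j i z))
    (hex : ∀ (n j : ℕ) (z : semilocCoh S κ θ' P w n (j + 1) i), semilocRedLE S κ θ' P w i n (Nat.le_add_left 1 j) z = 0 → ∃ y, ι n j y = z)
    {B : ℕ} (hB : ∀ n : ℕ, Nat.card (semilocCoh S κ θ' P w n 1 i) ≤ B) :
    letI := L.moduleIwasawa
    Module.Finite (IwasawaAlgebra p) L.H := by
  letI := L.moduleIwasawa
  letI : Module ℤ_[p] L.H := Module.compHom L.H (algebraMap ℤ_[p] (IwasawaAlgebra p))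
  haveI : IsScalarTower ℤ_[p] (IwasawaAlgebra p) L.H := IsScalarTower.of_compHom _ _ _
  haveI := L.moduleFinite_padicInt_of_levels hfin ι hιc hιr hp hex hB
  exact Module.Finite.of_restrictScalars_finite ℤ_[p] (IwasawaAlgebra p) L.H

end Semiloc

/-! ## §5. Torsion, and the product over `S₀` -/

section Torsion

variable {p : ℕ} [Fact p.Prime]

/-- ★ **A `Λ`-module finitely generated over `ℤ_p` is `Λ`-torsion** (compatible structures): for `x ∈ M` the chain of `ℤ_p`-submodules `span{x, Tx, …, T^m x}` stabilises
(`M` is Noetherian over `ℤ_p`), so `T^{m+1} x = Σ_{j ≤ m} a_j T^j x` and the MONIC `f = T^{m+1} − Σ a_j T^j ≠ 0` kills `x`. [cite: Washington1997, §13.2 Lemma 13.16] [folklore] -/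
theorem isTorsion_of_moduleFinite_padicInt {M : Type*} [AddCommGroup M] [Module (IwasawaAlgebra p) M] [Module ℤ_[p] M]
    [IsScalarTower ℤ_[p] (IwasawaAlgebra p) M] [Module.Finite ℤ_[p] M] : Module.IsTorsion (IwasawaAlgebra p) M := by
  intro x
  haveI : IsNoetherian ℤ_[p] M := isNoetherian_of_isNoetherianRing_of_finite ℤ_[p] M
  let v : ∀ m : ℕ, Fin (m + 1) → M := fun m j ↦ ((PowerSeries.X : IwasawaAlgebra p) ^ (j : ℕ)) • x
  have hmono : Monotone fun m : ℕ ↦ Submodule.span ℤ_[p] (Set.range (v m)) := by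
    intro m m' hmm'
    refine Submodule.span_mono ?_
    rintro _ ⟨j, rfl⟩
    exact ⟨⟨j, lt_of_lt_of_le j.2 (Nat.succ_le_succ hmm')⟩, rfl⟩
  obtain ⟨m, hm⟩ := monotone_stabilizes_iff_noetherian.mpr inferInstance ⟨fun m ↦ Submodule.span ℤ_[p] (Set.range (v m)), hmono⟩
  have hmem : ((PowerSeries.X : IwasawaAlgebra p) ^ (m + 1)) • x ∈ Submodule.span ℤ_[p] (Set.range (v m)) := by
    have h := hm (m + 1) (Nat.le_succ m)
    change Submodule.span ℤ_[p] (Set.range (v m)) = Submodule.span ℤ_[p] (Set.range (v (m + 1))) at h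
    rw [h]
    exact Submodule.subset_span ⟨⟨m + 1, Nat.lt_succ_self _⟩, rfl⟩
  obtain ⟨a, ha⟩ := (Submodule.mem_span_range_iff_exists_fun ℤ_[p]).mp hmem
  -- the monic relation
  let f : IwasawaAlgebra p := (PowerSeries.X : IwasawaAlgebra p) ^ (m + 1) - ∑ j : Fin (m + 1), PowerSeries.C (a j) * (PowerSeries.X : IwasawaAlgebra p) ^ (j : ℕ)
  have hf : f ≠ 0 := by
    intro h
    have hc := congrArg (PowerSeries.coeff (m + 1)) h
    rw [map_sub, PowerSeries.coeff_X_pow, if_pos rfl, map_sum, map_zero, sub_eq_zero] at hc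
    have hzero : ∑ j : Fin (m + 1), PowerSeries.coeff (m + 1) (PowerSeries.C (a j) * (PowerSeries.X : IwasawaAlgebra p) ^ (j : ℕ)) = 0 := by
      refine Finset.sum_eq_zero fun j _ ↦ ?_
      rw [PowerSeries.coeff_C_mul, PowerSeries.coeff_X_pow, if_neg (Nat.ne_of_gt j.2), mul_zero]
    rw [hzero] at hc
    exact one_ne_zero hc
  refine ⟨⟨f, mem_nonZeroDivisors_of_ne_zero hf⟩, ?_⟩
  change f • x = 0
  have hsum : (∑ j : Fin (m + 1), PowerSeries.C (a j) * (PowerSeries.X : IwasawaAlgebra p) ^ (j : ℕ)) • x = ∑ j : Fin (m + 1), a j • v m j := by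
    rw [Finset.sum_smul]
    refine Finset.sum_congr rfl fun j _ ↦ ?_
    rw [mul_smul, PowerSeries.C_eq_algebraMap, algebraMap_smul]
  rw [sub_smul, hsum, ha, sub_self]

/-- **A finite product of `Λ`-torsion modules is `Λ`-torsion** (product of the annihilators, `Λ` a domain). [folklore] -/
theorem isTorsion_pi_of_forall {ι : Type*} [Fintype ι] {M : ι → Type*} [∀ j, AddCommGroup (M j)] [∀ j, Module (IwasawaAlgebra p) (M j)]
    (h : ∀ j, Module.IsTorsion (IwasawaAlgebra p) (M j)) : Module.IsTorsion (IwasawaAlgebra p) (∀ j, M j) := by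
  intro x
  choose a ha using fun j ↦ @h j (x j)
  refine ⟨⟨∏ j, (a j : IwasawaAlgebra p), Submonoid.prod_mem _ fun j _ ↦ (a j).2⟩, funext fun j ↦ ?_⟩
  change (∏ j', (a j' : IwasawaAlgebra p)) • x j = 0
  obtain ⟨b, hb⟩ := Finset.dvd_prod_of_mem (fun j' ↦ (a j' : IwasawaAlgebra p)) (Finset.mem_univ j)
  rw [hb, mul_comm, mul_smul, show (a j : IwasawaAlgebra p) • x j = 0 from ha j, smul_zero]

end Torsion

section Pi

variable {K : Type} [Field K] [NumberField K] {p : ℕ} [Fact p.Prime] {S : Set (PadicAlgCl p)} {κ : ZpExtension K p} {γ : absoluteGaloisGroup K}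
  {θ' : absoluteGaloisGroup K →ₜ* (padicCoeffIntegers S)ˣ} {P : Set (HeightOneSpectrum (𝓞 K))} {i : ℕ}

/-- ★★★ **T5's `hfin` ∧ `htors` FROM LEVELWISE INPUTS**: for semilocal Iwasawa data `L w` at the places `w` of a finite set `S₀`, if at every `w ∈ S₀` the levels are finite, (E1)/(E2) hold
for some «incl» maps and the mod-`p` levels are uniformly bounded, then `Π_{w∈S₀} (L w).H` is finitely generated AND torsion over `Λ` (structure `moduleIwasawa` componentwise).
[cite: Washington1997, §13.2 Lemma 13.16] [cite: NeukirchSchmidtWingberg2008, (5.3.10), (8.6.2)–(8.6.3)] [cite: Rubin2000, App. B.3] [cite: PerrinRiou1994Invent, §1.3] -/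
theorem moduleFinite_and_isTorsion_pi_of_levels (S₀ : Set (HeightOneSpectrum (𝓞 K))) (hS₀ : S₀.Finite)
    (L : ∀ w : HeightOneSpectrum (𝓞 K), SemilocIwasawaCohomologyDataO S κ γ θ' P w i)
    (hfin : ∀ w ∈ S₀, ∀ n k : ℕ, Finite (semilocCoh S κ θ' P w n k i))
    (hlev : ∀ w ∈ S₀, ∃ ι : ∀ n j : ℕ, semilocCoh S κ θ' P w n j i →+ semilocCoh S κ θ' P w n (j + 1) i,
      (∀ (n j : ℕ) (y : semilocCoh S κ θ' P w (n + 1) j i), semilocCores S κ θ' P w n (j + 1) i (ι (n + 1) j y) = ι n j (semilocCores S κ θ' P w n j i y)) ∧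
      (∀ (n j : ℕ) (y : semilocCoh S κ θ' P w n (j + 1) i), semilocRed S κ θ' P w n (j + 1) i (ι n (j + 1) y) = ι n j (semilocRed S κ θ' P w n j i y)) ∧
      (∀ (n j : ℕ) (z : semilocCoh S κ θ' P w n (j + 1) i), p • z = ι n j (semilocRed S κ θ' P w n j i z)) ∧
      (∀ (n j : ℕ) (z : semilocCoh S κ θ' P w n (j + 1) i), semilocRedLE S κ θ' P w i n (Nat.le_add_left 1 j) z = 0 → ∃ y, ι n j y = z))
    (hB : ∀ w ∈ S₀, ∃ B : ℕ, ∀ n : ℕ, Nat.card (semilocCoh S κ θ' P w n 1 i) ≤ B) :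
    letI : ∀ w : HeightOneSpectrum (𝓞 K), Module (IwasawaAlgebra p) (L w).H := fun w ↦ (L w).moduleIwasawa
    Module.Finite (IwasawaAlgebra p) (∀ w : S₀, (L w).H) ∧ Module.IsTorsion (IwasawaAlgebra p) (∀ w : S₀, (L w).H) := by
  letI : ∀ w : HeightOneSpectrum (𝓞 K), Module (IwasawaAlgebra p) (L w).H := fun w ↦ (L w).moduleIwasawa
  haveI := hS₀.fintype
  have hw : ∀ w : S₀, Module.Finite (IwasawaAlgebra p) (L w).H := fun w ↦ by
    obtain ⟨ι, hιc, hιr, hp, hex⟩ := hlev w w.2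
    obtain ⟨B, hB'⟩ := hB w w.2
    exact (L w).moduleFinite_iwasawa_of_levels (hfin w w.2) ι hιc hιr hp hex hB'
  haveI : ∀ w : S₀, Module.Finite (IwasawaAlgebra p) (L w).H := hw
  refine ⟨inferInstance, isTorsion_pi_of_forall fun w ↦ ?_⟩
  letI : Module ℤ_[p] (L w).H := Module.compHom (L w).H (algebraMap ℤ_[p] (IwasawaAlgebra p))
  haveI : IsScalarTower ℤ_[p] (IwasawaAlgebra p) (L w).H := IsScalarTower.of_compHom _ _ _
  obtain ⟨ι, hιc, hιr, hp, hex⟩ := hlev w w.2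
  obtain ⟨B, hB'⟩ := hB w w.2
  haveI := (L w).moduleFinite_padicInt_of_levels (hfin w w.2) ι hιc hιr hp hex hB'
  exact isTorsion_of_moduleFinite_padicInt

end Pi

end Summit.BirchSwinnertonDyer.BirchSwinnertonDyer.Theorems.SmallImageRttD2Seq

end
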